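import Mathlib
import Summits.Ventures.PercRepro2.Defs
import Summits.Ventures.PercRepro2.Independence
import Summits.Ventures.PercRepro2.Harris
import Summits.Ventures.PercRepro2.Graph
import Summits.Ventures.PercRepro2.Exploration
import Summits.Ventures.PercRepro2.Events
import Summits.Ventures.PercRepro2.Induced
import Summits.Ventures.PercRepro2.BHK
import Summits.Ventures.PercRepro2.BHKEvents
import Summits.Ventures.PercRepro2.OneEdge
import Summits.Ventures.PercRepro2.RBRoot
import Summits.Ventures.PercRepro2.RBRootEdge

/-!
# Row 2′RB: removing a root edge at the third vertex, II — affinity of the Rao–Blackwell sum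
(mine-a g5; MINE-A.md §31 / §21 (I1))

For `e = {w, s}` the Rao–Blackwell sum `RBRoot.rbSum p ends s t w X Y` is AFFINE in `p e`:
`rbSum p = p e · rbSum p[e↦1] + (1 − p e) · rbSum p[e↦0]` for `(X, Y) = ({b ↔ s}, {o ↔ s})`
(`rbSum_pin_same`) and `({b ↔ s}, {o ↔ t})` (`rbSum_pin_cross`) — atom by atom: on `{C(w) = A}`
with `s ∉ A` the edge is closed, with `s ∈ A` it is internal and invisible to the residual law.
-/

namespace Summit.Ventures.PercRepro2

namespace RBRootEdge

open scoped Classical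

section Pin2

variable {V : Type*} {E : Type*} [Fintype E] [DecidableEq E] [Fintype V] {R : Type*} [Field R]
  [LinearOrder R] [IsStrictOrderedRing R] (p : E → R) (ends : E → Sym2 V) (s t w : V) {e : E}

variable {p}

omit [Fintype V] in
/-- **Affinity of the atom term, same version** (`X = {b ↔ s}`, `Y = {o ↔ s}`): the term of the
Rao–Blackwell sum at the atom `A` is `p e · term(p[e↦1]) + (1 − p e) · term(p[e↦0])`. -/
lemma term_pin_same (hp : IsProbVec p) (hends : ends e = s(w, s)) (o b : V) (A : Set V) :
    prob p ((connEvent ends s t)ᶜ ∩ clusterEvent ends w A ∩ connEvent ends b s) *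
        prob p ((connEvent ends s t)ᶜ ∩ clusterEvent ends w A ∩ connEvent ends o s) /
      prob p ((connEvent ends s t)ᶜ ∩ clusterEvent ends w A) =
    p e * (prob (Function.update p e 1) ((connEvent ends s t)ᶜ ∩ clusterEvent ends w A ∩
            connEvent ends b s) *
          prob (Function.update p e 1) ((connEvent ends s t)ᶜ ∩ clusterEvent ends w A ∩
            connEvent ends o s) /
        prob (Function.update p e 1) ((connEvent ends s t)ᶜ ∩ clusterEvent ends w A)) +
      (1 - p e) * (prob (Function.update p e 0) ((connEvent ends s t)ᶜ ∩ clusterEvent ends w A ∩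
            connEvent ends b s) *
          prob (Function.update p e 0) ((connEvent ends s t)ᶜ ∩ clusterEvent ends w A ∩
            connEvent ends o s) /
        prob (Function.update p e 0) ((connEvent ends s t)ᶜ ∩ clusterEvent ends w A)) := by
  by_cases hs : s ∈ A
  · by_cases ht : t ∈ A
    · rw [compl_inter_atom_of_mem_mem ends s t w hs ht]
      simp
    · rw [compl_inter_atom_of_mem_notMem ends s t w hs ht]
      refine affine_of_factor (prob_eq_pin p _ e) (prob_atom_inter_conn_root p ends s w hs b)
        (prob_atom_inter_conn_root _ ends s w hs b) (prob_atom_inter_conn_root _ ends s w hs b)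
        (prob_atom_inter_conn_root p ends s w hs o) (prob_atom_inter_conn_root _ ends s w hs o)
        (prob_atom_inter_conn_root _ ends s w hs o)
  · have hp0 : IsProbVec (Function.update p e 0) := hp.update e le_rfl zero_le_one
    rw [Set.inter_right_comm _ _ (connEvent ends b s), Set.inter_right_comm _ _ (connEvent ends o s)]
    set d0 := prob (Function.update p e 0) ((connEvent ends s t)ᶜ ∩ clusterEvent ends w A) with hd0
    set a0 := prob (Function.update p e 0) ((connEvent ends s t)ᶜ ∩ connEvent ends b s ∩
      clusterEvent ends w A) with ha0
    set b0 := prob (Function.update p e 0) ((connEvent ends s t)ᶜ ∩ connEvent ends o s ∩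
      clusterEvent ends w A) with hb0
    have ha0' : a0 = d0 * (a0 / d0) := by
      by_cases h : d0 = 0
      · have hle : a0 ≤ d0 := prob_mono hp0 fun ω hω => ⟨hω.1.1, hω.2⟩
        rw [h] at hle
        rw [le_antisymm hle (prob_nonneg hp0 _), h]
        simp
      · rw [mul_div_cancel₀ _ h]
    have hb0' : b0 = d0 * (b0 / d0) := by
      by_cases h : d0 = 0
      · have hle : b0 ≤ d0 := prob_mono hp0 fun ω hω => ⟨hω.1.1, hω.2⟩
        rw [h] at hle
        rw [le_antisymm hle (prob_nonneg hp0 _), h]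
        simp
      · rw [mul_div_cancel₀ _ h]
    refine affine_of_factor (c₁ := a0 / d0) (c₂ := b0 / d0) (prob_eq_pin p _ e) ?_ ha0' ?_ ?_ hb0' ?_
    · rw [prob_atom_of_notMem p ends s w hends hs ((connEvent ends s t)ᶜ ∩ connEvent ends b s),
        prob_atom_of_notMem p ends s w hends hs (connEvent ends s t)ᶜ, ← ha0, ← hd0, mul_assoc,
        ← ha0']
    · rw [prob_update_one_atom_of_notMem p ends s w hends hs ((connEvent ends s t)ᶜ ∩ connEvent ends b s),
        prob_update_one_atom_of_notMem p ends s w hends hs (connEvent ends s t)ᶜ, zero_mul]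
    · rw [prob_atom_of_notMem p ends s w hends hs ((connEvent ends s t)ᶜ ∩ connEvent ends o s),
        prob_atom_of_notMem p ends s w hends hs (connEvent ends s t)ᶜ, ← hb0, ← hd0, mul_assoc,
        ← hb0']
    · rw [prob_update_one_atom_of_notMem p ends s w hends hs ((connEvent ends s t)ᶜ ∩ connEvent ends o s),
        prob_update_one_atom_of_notMem p ends s w hends hs (connEvent ends s t)ᶜ, zero_mul]


/-- **Affinity of the atom term, cross version** (`X = {b ↔ s}`, `Y = {o ↔ t}`). -/
lemma term_pin_cross (hp : IsProbVec p) (hends : ends e = s(w, s)) (o b : V) (A : Set V) :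
    prob p ((connEvent ends s t)ᶜ ∩ clusterEvent ends w A ∩ connEvent ends b s) *
        prob p ((connEvent ends s t)ᶜ ∩ clusterEvent ends w A ∩ connEvent ends o t) /
      prob p ((connEvent ends s t)ᶜ ∩ clusterEvent ends w A) =
    p e * (prob (Function.update p e 1) ((connEvent ends s t)ᶜ ∩ clusterEvent ends w A ∩
            connEvent ends b s) *
          prob (Function.update p e 1) ((connEvent ends s t)ᶜ ∩ clusterEvent ends w A ∩
            connEvent ends o t) /
        prob (Function.update p e 1) ((connEvent ends s t)ᶜ ∩ clusterEvent ends w A)) +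
      (1 - p e) * (prob (Function.update p e 0) ((connEvent ends s t)ᶜ ∩ clusterEvent ends w A ∩
            connEvent ends b s) *
          prob (Function.update p e 0) ((connEvent ends s t)ᶜ ∩ clusterEvent ends w A ∩
            connEvent ends o t) /
        prob (Function.update p e 0) ((connEvent ends s t)ᶜ ∩ clusterEvent ends w A)) := by
  by_cases hs : s ∈ A
  · by_cases ht : t ∈ A
    · rw [compl_inter_atom_of_mem_mem ends s t w hs ht]
      simp
    · rw [compl_inter_atom_of_mem_notMem ends s t w hs ht]
      have h1 := prob_atom_inter_conn_other (Function.update p e 1) ends t w ht o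
      have h0 := prob_atom_inter_conn_other (Function.update p e 0) ends t w ht o
      rw [kappa_update_one p ends s t w hends hs o] at h1
      rw [kappa_update_zero p ends s t w hends hs o] at h0
      exact affine_of_factor (prob_eq_pin p _ e) (prob_atom_inter_conn_root p ends s w hs b)
        (prob_atom_inter_conn_root _ ends s w hs b) (prob_atom_inter_conn_root _ ends s w hs b)
        (prob_atom_inter_conn_other p ends t w ht o) h0 h1
  · have hp0 : IsProbVec (Function.update p e 0) := hp.update e le_rfl zero_le_one
    rw [Set.inter_right_comm _ _ (connEvent ends b s), Set.inter_right_comm _ _ (connEvent ends o t)]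
    set d0 := prob (Function.update p e 0) ((connEvent ends s t)ᶜ ∩ clusterEvent ends w A) with hd0
    set a0 := prob (Function.update p e 0) ((connEvent ends s t)ᶜ ∩ connEvent ends b s ∩
      clusterEvent ends w A) with ha0
    set b0 := prob (Function.update p e 0) ((connEvent ends s t)ᶜ ∩ connEvent ends o t ∩
      clusterEvent ends w A) with hb0
    have ha0' : a0 = d0 * (a0 / d0) := by
      by_cases h : d0 = 0
      · have hle : a0 ≤ d0 := prob_mono hp0 fun ω hω => ⟨hω.1.1, hω.2⟩
        rw [h] at hle
        rw [le_antisymm hle (prob_nonneg hp0 _), h]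
        simp
      · rw [mul_div_cancel₀ _ h]
    have hb0' : b0 = d0 * (b0 / d0) := by
      by_cases h : d0 = 0
      · have hle : b0 ≤ d0 := prob_mono hp0 fun ω hω => ⟨hω.1.1, hω.2⟩
        rw [h] at hle
        rw [le_antisymm hle (prob_nonneg hp0 _), h]
        simp
      · rw [mul_div_cancel₀ _ h]
    refine affine_of_factor (c₁ := a0 / d0) (c₂ := b0 / d0) (prob_eq_pin p _ e) ?_ ha0' ?_ ?_ hb0' ?_
    · rw [prob_atom_of_notMem p ends s w hends hs ((connEvent ends s t)ᶜ ∩ connEvent ends b s),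
        prob_atom_of_notMem p ends s w hends hs (connEvent ends s t)ᶜ, ← ha0, ← hd0, mul_assoc,
        ← ha0']
    · rw [prob_update_one_atom_of_notMem p ends s w hends hs ((connEvent ends s t)ᶜ ∩ connEvent ends b s),
        prob_update_one_atom_of_notMem p ends s w hends hs (connEvent ends s t)ᶜ, zero_mul]
    · rw [prob_atom_of_notMem p ends s w hends hs ((connEvent ends s t)ᶜ ∩ connEvent ends o t),
        prob_atom_of_notMem p ends s w hends hs (connEvent ends s t)ᶜ, ← hb0, ← hd0, mul_assoc,
        ← hb0']
    · rw [prob_update_one_atom_of_notMem p ends s w hends hs ((connEvent ends s t)ᶜ ∩ connEvent ends o t),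
        prob_update_one_atom_of_notMem p ends s w hends hs (connEvent ends s t)ᶜ, zero_mul]

/-- **Affinity of the Rao–Blackwell sum in the weight of a root edge, same version.** -/
theorem rbSum_pin_same (hp : IsProbVec p) (hends : ends e = s(w, s)) (o b : V) :
    RBRoot.rbSum p ends s t w (connEvent ends b s) (connEvent ends o s) =
      p e * RBRoot.rbSum (Function.update p e 1) ends s t w (connEvent ends b s) (connEvent ends o s) +
        (1 - p e) * RBRoot.rbSum (Function.update p e 0) ends s t w (connEvent ends b s)
          (connEvent ends o s) := by
  unfold RBRoot.rbSum
  rw [Finset.mul_sum, Finset.mul_sum, ← Finset.sum_add_distrib]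
  exact Finset.sum_congr rfl fun A _ => term_pin_same ends s t w hp hends o b A

/-- **Affinity of the Rao–Blackwell sum in the weight of a root edge, cross version.** -/
theorem rbSum_pin_cross (hp : IsProbVec p) (hends : ends e = s(w, s)) (o b : V) :
    RBRoot.rbSum p ends s t w (connEvent ends b s) (connEvent ends o t) =
      p e * RBRoot.rbSum (Function.update p e 1) ends s t w (connEvent ends b s) (connEvent ends o t) +
        (1 - p e) * RBRoot.rbSum (Function.update p e 0) ends s t w (connEvent ends b s)
          (connEvent ends o t) := by
  unfold RBRoot.rbSum
  rw [Finset.mul_sum, Finset.mul_sum, ← Finset.sum_add_distrib]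
  exact Finset.sum_congr rfl fun A _ => term_pin_cross ends s t w hp hends o b A

end Pin2


end RBRootEdge

end Summit.Ventures.PercRepro2
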